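import Summits.ResolutionOfSingularities.ResolutionOfSingularities.Theorems.HilbertSamuelEliminationSigmaMaxModificationsCorridor3WLadderRecognitionNearLocusFibres
import Summits.ResolutionOfSingularities.ResolutionOfSingularities.Theorems.HilbertSamuelEliminationSigmaMaxModificationsCorridor3WLadderRecognitionIso
import Literature.AlgebraicGeometry.Resolution.PointBlowupHsFunMono
import Literature.AlgebraicGeometry.Resolution.ResolutionGlue
import HarnessLib

/-!
# [OURS · L1 W4.2] RECOGNITION-GEOMETRY (R2): THE WAITING STEP — when the centre MISSES the near locus, `π_{j+1}` maps `N_{j+1}(x)`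
# bijectively (indeed isomorphically) onto `N_j(x)` and every shape statement transfers
# (crux chain w42, line `w_ladder`; `--supports stmt-…-19249`, helper)

OURS (cell res-hironaka, slot W4.2, seat res-L1-w42-stub-2 gen 4); NOT statements of H. Hironaka's manuscript [Hironaka2017]
nor of [CossartJannsenSaito2020]. AI-drafted, weaker than expert review. Sorry-free PROOF file (no new definition), FACT-FREE.

For res-D-pv-038's stage induction on the UNCOMPRESSED localised tower (plan-1 RULING v3.14-19 (FK)): at a WAITING step
(`C_j ∩ N_j(x) = ∅`) the blow-up `π_{j+1}` is an isomorphism over `X_j ∖ C_j ⊇ N_j(x)` (tree `IsBlowup.isIso_morphismRestrict`,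
Görtz–Wedhorn Prop. 13.91 (3)), so

* `preimage_nearLocus_eq_of_disjoint` — `π_{j+1}⁻¹(N_j(x)) = N_{j+1}(x)`; `bijOn_nearLocus_succ_of_disjoint` — `π_{j+1} : N_{j+1}(x) → N_j(x)`
  is a BIJECTION; `finite_nearLocus_succ_iff_of_disjoint`, `nontrivial_nearLocus_succ_iff_of_disjoint`,
  `isIrreducible_nearLocus_succ_iff_of_disjoint`, `isClosed_singleton_iff_of_disjoint` — finiteness, nontriviality, irreducibility and
  closedness of points transfer BOTH ways;
* `isIso_residueFieldMap_of_not_mem_centre` — trivial residue extensions off the centre;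
* **`inducesIsoOn_nearLocus_succ_of_disjoint`** — if `N_j(x)` is irreducible with REGULAR reduced structure, `π_{j+1}` induces an
  isomorphism `N_{j+1}(x) ⥲ N_j(x)` of reduced closed subschemes ((R3′) of `…RecognitionIso`), hence
  **`isRegular_nearLocus_succ_of_disjoint`** — (RegN) transfers through waiting steps.

## References

* U. Görtz, T. Wedhorn, *Algebraic Geometry I* (2020), Prop. 13.91 (3). [GortzWedhorn2020]
* V. Cossart, U. Jannsen, S. Saito, LNM 2270 (2020): Def. 6.38 (iii)–(iv), p. 104, p. 107. [CossartJannsenSaito2020]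
-/

noncomputable section

-- namespace `…Corridor3.Helpers` re-enters `…Corridor3`
set_option linter.dupNamespace false

open CategoryTheory AlgebraicGeometry TopologicalSpace IsLocalRing
open Literature.AlgebraicGeometry.Resolution
open Scheme.IdealSheafData

universe u

open Literature.AlgebraicGeometry.CossartJannsenSaito2020

namespace Summit.ResolutionOfSingularities.ResolutionOfSingularities.Theorems.SigmaMaxModificationsCorridor3.Helpers

/-! ## §0. A morphism with bijective stalk map has a trivial residue extension -/

/-- If `f^♯_x : 𝒪_{Y,f x} → 𝒪_{X,x}` is surjective (e.g. an isomorphism), the residue extension `κ(f x) → κ(x)` is trivial. [folklore] -/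
theorem isIso_residueFieldMap_of_stalkMap_surjective {X Y : Scheme.{u}} (f : X ⟶ Y) (x : X)
    (h : Function.Surjective (f.stalkMap x)) : IsIso (f.residueFieldMap x) := by
  have hsurj : Function.Surjective (f.residueFieldMap x) := by
    intro a
    obtain ⟨b, rfl⟩ := X.residue_surjective x a
    obtain ⟨c, rfl⟩ := h b
    refine ⟨Y.residue (f.base x) c, ?_⟩
    change (Y.residue (f.base x) ≫ f.residueFieldMap x) c = (f.stalkMap x ≫ X.residue x) c
    rw [Scheme.residue_residueFieldMap]
  exact (ConcreteCategory.isIso_iff_bijective _).mpr ⟨(f.residueFieldMap x).hom.injective, hsurj⟩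

namespace BlowupTowerNear

variable (T : BlowupTower.{u}) {N : ℕ}

/-! ## §1. Off the centre the blow-up is a local isomorphism -/

/-- `H` is unchanged at a point of `X_{j+1}` NOT over the centre `C_j`. [cite: StacksProject, Tag 02OS] -/
theorem hsFun_eq_of_not_mem_centre (j : ℕ) {z : T.X (j + 1)} (hz : (T.π j).base z ∉ T.C j) :
    Scheme.hsFun (T.X (j + 1)) N z = Scheme.hsFun (T.X j) N ((T.π j).base z) := by
  haveI : ∀ j, IsLocallyNoetherian (T.X j) := T.ln
  exact (T.isBlowup j).hsFun_eq_of_not_mem (Z := ⟨T.C j, T.isClosed_C j⟩) hz N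

/-- The residue extension is trivial at a point NOT over the centre. [cite: StacksProject, Tag 02OS] -/
theorem isIso_residueFieldMap_of_not_mem_centre (j : ℕ) {z : T.X (j + 1)} (hz : (T.π j).base z ∉ T.C j) :
    IsIso ((T.π j).residueFieldMap z) := by
  haveI : ∀ j, IsLocallyNoetherian (T.X j) := T.ln
  haveI := (T.isBlowup j).isIso_stalkMap_of_not_mem_vanishingIdeal (Z := ⟨T.C j, T.isClosed_C j⟩) hz
  exact isIso_residueFieldMap_of_stalkMap_surjective (T.π j) z
    (ConcreteCategory.bijective_of_isIso ((T.π j).stalkMap z)).2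

/-- **`π_{j+1}` is injective on the complement of `π_{j+1}⁻¹(C_j)` and hits every point off `C_j`** (it restricts to an isomorphism
`π⁻¹(X_j ∖ C_j) ≅ X_j ∖ C_j`). [cite: GortzWedhorn2020, Prop. 13.91 (3)] -/
theorem bijOn_compl_centre (j : ℕ) : Set.BijOn (T.π j).base ((T.π j).base ⁻¹' (T.C j)ᶜ) (T.C j)ᶜ := by
  haveI : ∀ j, IsLocallyNoetherian (T.X j) := T.ln
  set U : (T.X j).Opens := ⟨(T.C j)ᶜ, (T.isClosed_C j).isOpen_compl⟩ with hU
  have hdisj : Disjoint (U : Set (T.X j)) (T.centreIdeal j).support := by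
    rw [BlowupTower.centreIdeal, Scheme.IdealSheafData.coe_support_vanishingIdeal]
    exact disjoint_compl_left
  haveI hiso : IsIso (T.π j ∣_ U) := (T.isBlowup j).isIso_morphismRestrict hdisj
  let e := Scheme.homeoOfIso (asIso (T.π j ∣_ U))
  have he : ∀ z : ↥((T.π j) ⁻¹ᵁ U), (e z).1 = (T.π j).base z.1 := fun z => morphismRestrict_base_coe (T.π j) U z
  refine ⟨fun z hz => hz, ?_, ?_⟩
  · intro a ha b hb hab
    have h1 : e ⟨a, ha⟩ = e ⟨b, hb⟩ := Subtype.ext (by rw [he, he]; exact hab)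
    exact congrArg Subtype.val (e.injective h1)
  · intro y hy
    obtain ⟨z, hz⟩ := e.surjective ⟨y, hy⟩
    refine ⟨z.1, ?_, ?_⟩
    · show (T.π j).base z.1 ∈ (T.C j)ᶜ
      rw [← he, hz]; exact hy
    · rw [← he, hz]

/-! ## §2. The waiting step: the centre misses the near locus -/

/-- **At a waiting step `π_{j+1}⁻¹(N_j(x)) = N_{j+1}(x)`**: every point over a near point off the centre is near (`H` is unchanged).
[cite: CossartJannsenSaito2020, Def. 6.38 (iii), p. 107] -/
theorem preimage_nearLocus_eq_of_disjoint (hkey : KeySetting T N) (hperm : ∀ j, IdealSheafData.IsPermissible (T.centreIdeal j))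
    (x : T.X 0) (j : ℕ) (hW : Disjoint (T.C j) (T.nearLocus N x j)) :
    (T.π j).base ⁻¹' T.nearLocus N x j = T.nearLocus N x (j + 1) := by
  ext z
  constructor
  · intro hz
    exact mem_nearLocus_succ_of_near T hkey hperm x j hz
      (hsFun_eq_of_not_mem_centre T j fun hC => Set.disjoint_left.mp hW hC hz)
  · intro hz
    exact ((mem_nearLocus_succ_iff T hkey hperm x j z).mp hz).1

/-- **At a waiting step `π_{j+1} : N_{j+1}(x) → N_j(x)` is a BIJECTION.** [cite: CossartJannsenSaito2020, Def. 6.38 (iii), p. 107] -/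
theorem bijOn_nearLocus_succ_of_disjoint (hkey : KeySetting T N) (hperm : ∀ j, IdealSheafData.IsPermissible (T.centreIdeal j))
    (x : T.X 0) (j : ℕ) (hW : Disjoint (T.C j) (T.nearLocus N x j)) :
    Set.BijOn (T.π j).base (T.nearLocus N x (j + 1)) (T.nearLocus N x j) := by
  have hpre := preimage_nearLocus_eq_of_disjoint T hkey hperm x j hW
  have hsub : T.nearLocus N x j ⊆ (T.C j)ᶜ := fun y hy hC => Set.disjoint_left.mp hW hC hy
  have hbij := bijOn_compl_centre T j
  refine ⟨fun z hz => by rw [← hpre] at hz; exact hz, ?_, ?_⟩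
  · exact fun a ha b hb hab => hbij.injOn (hsub (hpre ▸ ha : a ∈ (T.π j).base ⁻¹' T.nearLocus N x j))
      (hsub (hpre ▸ hb : b ∈ (T.π j).base ⁻¹' T.nearLocus N x j)) hab
  · intro y hy
    obtain ⟨z, -, rfl⟩ := hbij.surjOn (hsub hy)
    exact ⟨z, by rw [← hpre]; exact hy, rfl⟩

/-- The fibre of `π_{j+1}` over a point off the centre is a single point. [cite: GortzWedhorn2020, Prop. 13.91 (3)] -/
theorem preimage_singleton_eq_of_not_mem_centre (j : ℕ) {z : T.X (j + 1)} (hz : (T.π j).base z ∉ T.C j) :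
    (T.π j).base ⁻¹' {(T.π j).base z} = {z} := by
  ext w
  simp only [Set.mem_preimage, Set.mem_singleton_iff]
  constructor
  · intro hw
    exact (bijOn_compl_centre T j).injOn (show (T.π j).base w ∈ (T.C j)ᶜ by rw [hw]; exact hz) hz hw
  · rintro rfl; rfl

/-- At a waiting step, a point of `N_{j+1}(x)` is closed iff its image is. [cite: CossartJannsenSaito2020, p. 107] -/
theorem isClosed_singleton_iff_of_disjoint (x : T.X 0) (j : ℕ) (hW : Disjoint (T.C j) (T.nearLocus N x j))
    (hkey : KeySetting T N) (hperm : ∀ j, IdealSheafData.IsPermissible (T.centreIdeal j))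
    {z : T.X (j + 1)} (hz : z ∈ T.nearLocus N x (j + 1)) :
    IsClosed ({z} : Set (T.X (j + 1))) ↔ IsClosed ({(T.π j).base z} : Set (T.X j)) := by
  haveI : ∀ j, IsLocallyNoetherian (T.X j) := T.ln
  haveI : IsProper (T.π j) := (T.isBlowup j).isProper
  have hy : (T.π j).base z ∈ T.nearLocus N x j := ((mem_nearLocus_succ_iff T hkey hperm x j z).mp hz).1
  have hyC : (T.π j).base z ∉ T.C j := fun hC => Set.disjoint_left.mp hW hC hy
  constructor
  · intro h; rw [← Set.image_singleton]; exact (T.π j).isClosedMap _ h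
  · intro h
    rw [← preimage_singleton_eq_of_not_mem_centre T j hyC]
    exact h.preimage (T.π j).continuous

/-- At a waiting step, `N_{j+1}(x)` is finite iff `N_j(x)` is. [cite: CossartJannsenSaito2020, p. 107] -/
theorem finite_nearLocus_succ_iff_of_disjoint (hkey : KeySetting T N) (hperm : ∀ j, IdealSheafData.IsPermissible (T.centreIdeal j))
    (x : T.X 0) (j : ℕ) (hW : Disjoint (T.C j) (T.nearLocus N x j)) :
    (T.nearLocus N x (j + 1)).Finite ↔ (T.nearLocus N x j).Finite := by
  have hbij := bijOn_nearLocus_succ_of_disjoint T hkey hperm x j hW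
  constructor
  · intro h; rw [← hbij.image_eq]; exact h.image _
  · intro h
    have hpre := preimage_nearLocus_eq_of_disjoint T hkey hperm x j hW
    rw [← hpre]
    exact h.preimage (by rw [hpre]; exact hbij.injOn)

/-- At a waiting step, `N_{j+1}(x)` is nontrivial iff `N_j(x)` is. [cite: CossartJannsenSaito2020, p. 107] -/
theorem nontrivial_nearLocus_succ_iff_of_disjoint (hkey : KeySetting T N)
    (hperm : ∀ j, IdealSheafData.IsPermissible (T.centreIdeal j)) (x : T.X 0) (j : ℕ) (hW : Disjoint (T.C j) (T.nearLocus N x j)) :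
    (T.nearLocus N x (j + 1)).Nontrivial ↔ (T.nearLocus N x j).Nontrivial := by
  have hbij := bijOn_nearLocus_succ_of_disjoint T hkey hperm x j hW
  constructor
  · rintro ⟨a, ha, b, hb, hab⟩
    exact ⟨_, hbij.mapsTo ha, _, hbij.mapsTo hb, fun h => hab (hbij.injOn ha hb h)⟩
  · rintro ⟨a, ha, b, hb, hab⟩
    obtain ⟨a', ha', rfl⟩ := hbij.surjOn ha
    obtain ⟨b', hb', rfl⟩ := hbij.surjOn hb
    exact ⟨a', ha', b', hb', fun h => hab (h ▸ rfl)⟩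

/-- At a waiting step, `N_{j+1}(x)` is irreducible iff `N_j(x)` is (continuous image; preimage under the open embedding
`π⁻¹(X_j ∖ C_j) ≅ X_j ∖ C_j ↪ X_j`). [cite: CossartJannsenSaito2020, p. 107] -/
theorem isIrreducible_nearLocus_succ_iff_of_disjoint (hkey : KeySetting T N)
    (hperm : ∀ j, IdealSheafData.IsPermissible (T.centreIdeal j)) (x : T.X 0) (j : ℕ) (hW : Disjoint (T.C j) (T.nearLocus N x j)) :
    IsIrreducible (T.nearLocus N x (j + 1)) ↔ IsIrreducible (T.nearLocus N x j) := by
  haveI : ∀ j, IsLocallyNoetherian (T.X j) := T.ln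
  have hbij := bijOn_nearLocus_succ_of_disjoint T hkey hperm x j hW
  have hpre := preimage_nearLocus_eq_of_disjoint T hkey hperm x j hW
  constructor
  · intro h; rw [← hbij.image_eq]; exact h.image _ (T.π j).continuous.continuousOn
  · intro h
    -- the open embedding `g : π⁻¹(U) → X_j`, `U = X_j ∖ C_j`
    set U : (T.X j).Opens := ⟨(T.C j)ᶜ, (T.isClosed_C j).isOpen_compl⟩ with hU
    have hdisj : Disjoint (U : Set (T.X j)) (T.centreIdeal j).support := by
      rw [BlowupTower.centreIdeal, Scheme.IdealSheafData.coe_support_vanishingIdeal]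
      exact disjoint_compl_left
    haveI hiso : IsIso (T.π j ∣_ U) := (T.isBlowup j).isIso_morphismRestrict hdisj
    let g : ↥((T.π j) ⁻¹ᵁ U) → T.X j := fun z => (T.π j).base z.1
    have hg : g = (fun y : ↥U => y.1) ∘ Scheme.homeoOfIso (asIso (T.π j ∣_ U)) := by
      funext z
      show (T.π j).base z.1 = (Scheme.homeoOfIso (asIso (T.π j ∣_ U)) z).1
      rw [Scheme.homeoOfIso_apply]
      exact (morphismRestrict_base_coe (T.π j) U z).symm
    have hge : Topology.IsOpenEmbedding g := by
      rw [hg]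
      exact U.2.isOpenEmbedding_subtypeVal.comp (Scheme.homeoOfIso (asIso (T.π j ∣_ U))).isOpenEmbedding
    have hsub : T.nearLocus N x j ⊆ (U : Set (T.X j)) := fun y hy hC => Set.disjoint_left.mp hW hC hy
    have hrange : Set.range g = (U : Set (T.X j)) := by
      apply subset_antisymm
      · rintro _ ⟨z, rfl⟩; exact z.2
      · intro y hy
        obtain ⟨w, hw, hwy⟩ := (bijOn_compl_centre T j).surjOn hy
        exact ⟨⟨w, hw⟩, hwy⟩
    have hne : (T.nearLocus N x j ∩ Set.range g).Nonempty := by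
      obtain ⟨y, hy⟩ := h.nonempty
      exact ⟨y, hy, hrange ▸ hsub hy⟩
    have hirr : IsIrreducible (g ⁻¹' T.nearLocus N x j) := h.preimage hge hne
    -- its image under the subtype inclusion is `N_{j+1}(x)`
    have himg : (fun z : ↥((T.π j) ⁻¹ᵁ U) => z.1) '' (g ⁻¹' T.nearLocus N x j) = T.nearLocus N x (j + 1) := by
      ext z
      constructor
      · rintro ⟨w, hw, rfl⟩
        rw [← hpre]; exact hw
      · intro hz
        have hzU : z ∈ (T.π j) ⁻¹ᵁ U := hsub ((mem_nearLocus_succ_iff T hkey hperm x j z).mp hz).1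
        exact ⟨⟨z, hzU⟩, by rw [Set.mem_preimage]; exact ((mem_nearLocus_succ_iff T hkey hperm x j z).mp hz).1, rfl⟩
    rw [← himg]
    exact hirr.image _ continuous_subtype_val.continuousOn

/-- **(iv)/(RegN) THROUGH A WAITING STEP: `π_{j+1}` induces an isomorphism `N_{j+1}(x) ⥲ N_j(x)` of reduced closed subschemes**
when `N_j(x)` is irreducible with REGULAR (hence normal) reduced structure (bijection, trivial residue extensions, (R3′)).
[cite: CossartJannsenSaito2020, Def. 6.38 (iv), p. 107] -/
theorem inducesIsoOn_nearLocus_succ_of_disjoint (hkey : KeySetting T N) (hperm : ∀ j, IdealSheafData.IsPermissible (T.centreIdeal j))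
    (x : T.X 0) (j : ℕ) (hW : Disjoint (T.C j) (T.nearLocus N x j)) (hN : IsClosed (T.nearLocus N x j))
    (hN' : IsClosed (T.nearLocus N x (j + 1))) (hirr : IsIrreducible (T.nearLocus N x j))
    (hreg : Scheme.IsRegular (vanishingIdeal (⟨T.nearLocus N x j, hN⟩ : Closeds (T.X j))).subscheme) :
    InducesIsoOn (T.π j) (T.nearLocus N x (j + 1)) hN' (T.nearLocus N x j) hN := by
  haveI : ∀ j, IsLocallyNoetherian (T.X j) := T.ln
  haveI : IsProper (T.π j) := (T.isBlowup j).isProper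
  have hbij := bijOn_nearLocus_succ_of_disjoint T hkey hperm x j hW
  refine inducesIsoOn_of_bijOn_of_isIso_residueFieldMap_generic (T.π j) hN' hN
    ((isIrreducible_nearLocus_succ_iff_of_disjoint T hkey hperm x j hW).mpr hirr) hirr hbij (fun z hz _ => ?_)
    (fun w => isIntegrallyClosed_stalk_of_isRegular hreg w)
  exact isIso_residueFieldMap_of_not_mem_centre T j fun hC => Set.disjoint_left.mp hW hC (hbij.mapsTo hz)

/-- **(RegN) transfers through a waiting step**: if `N_j(x)` is irreducible with regular reduced structure, so is `N_{j+1}(x)`.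
[cite: CossartJannsenSaito2020, Def. 6.38 (iv), p. 107] -/
theorem isRegular_nearLocus_succ_of_disjoint (hkey : KeySetting T N) (hperm : ∀ j, IdealSheafData.IsPermissible (T.centreIdeal j))
    (x : T.X 0) (j : ℕ) (hW : Disjoint (T.C j) (T.nearLocus N x j)) (hN : IsClosed (T.nearLocus N x j))
    (hN' : IsClosed (T.nearLocus N x (j + 1))) (hirr : IsIrreducible (T.nearLocus N x j))
    (hreg : Scheme.IsRegular (vanishingIdeal (⟨T.nearLocus N x j, hN⟩ : Closeds (T.X j))).subscheme) :
    Scheme.IsRegular (vanishingIdeal (⟨T.nearLocus N x (j + 1), hN'⟩ : Closeds (T.X (j + 1)))).subscheme := by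
  haveI : ∀ j, IsLocallyNoetherian (T.X j) := T.ln
  obtain ⟨e, -⟩ := inducesIsoOn_nearLocus_succ_of_disjoint T hkey hperm x j hW hN hN' hirr hreg
  exact Scheme.IsRegular.of_iso e.inv hreg

end BlowupTowerNear

end Summit.ResolutionOfSingularities.ResolutionOfSingularities.Theorems.SigmaMaxModificationsCorridor3.Helpers

end
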